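import Mathlib
import Summits.MatrixMultiplication.MatrixMultiplication.Theses.AutomaticSTPPDesigns
import Summits.MatrixMultiplication.MatrixMultiplication.Theorems.AutomaticSTPPDesignsAutomaticDesignBelowFourFifthsTransfer
import Summits.MatrixMultiplication.MatrixMultiplication.Theorems.AutomaticSTPPDesignsAutomaticDesignBelowFourFifthsStubTypedFreeDiagonal
import Summits.MatrixMultiplication.MatrixMultiplication.Theorems.AutomaticSTPPDesignsAutomaticDesignBelowFourFifthsStubDigitwise
import Summits.MatrixMultiplication.MatrixMultiplication.Theorems.AutomaticSTPPDesignsAutomaticDesignBelowFourFifthsStubSlicedSTPP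
import Summits.MatrixMultiplication.MatrixMultiplication.Theorems.AutomaticSTPPDesignsAutomaticDesignBelowFourFifthsStubPackingCount

/-!
# `AutomaticDesignBelowFourFifths` — PROVED (line `digit-sum-sliced-laser`)

Route `MatrixMultiplication/AutomaticSTPPDesigns`, crux `stmt-MatrixMultiplication-7357`: there are a
base `p ≥ 2` and three regular languages whose all-scales block family is STPP in every `ℤ/(p^k)`
and satisfies `p^k < ∑_w (|A_w||B_w||C_w|)^{4/5}` at infinitely many scales `k` — a finitely
described STPP design in a CYCLIC tower certifying `ω ≤ 2.4` through CKSU 2005 Thm. 5.5.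

Proof (Coppersmith–Winograd's level-1 laser design for `CW_6`, run inside ONE cyclic group):

1. `AutomaticDesignBelowFourFifths.stub_typedFreeDiagonal` — the typed free diagonal `Δ` of level
   triples of `CW_q^{⊗(3a+3b)}` (BCS 1997 Thm. 15.41 (B): weight 2 pointwise, pattern counts
   `a,a,a`, types `(a+2b, 2a, b)`, free, `binom·roth(3f) ≤ 288 f |Δ|`);
2. `AutomaticDesignBelowFourFifths.exists_slice` — pigeonhole: a digit sum `σ` taken by
   `≥ 6^a/(5a+1)` of the vectors `Fin a → Fin 6`;
3. `AutomaticDesignBelowFourFifths.stub_slicedSTPP` fed with `stub_digitwise` (Kummer: a relation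
   `[x]+[y]=[z]` in `ℤ/ℓ^N` with conserved digit sum is digitwise) — the sliced laser family is an
   `IsSTPP` family of `ℤ/8^{3a+3b}` with `|Δ|` blocks of size `|Sl|³`;
4. `AutomaticDesignBelowFourFifths.stub_packingCount` — at `a = 18c`, `b = c`, `c = 10^6` the packing
   sum `|Δ|·(|Sl|³)^{4/5}` exceeds `8^{3a+3b}` (CW 1990 §7: `ω < 2.38719 < 2.4`);
5. `AutomaticDesignBelowFourFifths.crux_of_cyclicDesign` — one finite cyclic design gives the crux
   (letterwise languages, carry-free digit powers; CKSU 2005 Lemma 5.4 along cyclic extensions).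

All five are proved in the tree (files `…AutomaticDesignBelowFourFifthsStub*.lean`,
`…AutomaticDesignBelowFourFifthsTransfer.lean`); this file is the composition.  The parameters are
kept opaque (`obtain ⟨c, hc⟩ : ∃ c, 10^6 ≤ c`) so that no numeral power is ever evaluated.
-/

-- single-conjunct summit: the mandated namespace repeats `MatrixMultiplication`.
set_option linter.dupNamespace false

noncomputable section

open Finset
open scoped BigOperators

namespace Summit.MatrixMultiplication.MatrixMultiplication.Theorems

namespace AutomaticDesignBelowFourFifths

/-- **Pigeonhole slice.** Among the `q^a` vectors `Fin a → Fin q` some coordinate sum `σ` is taken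
at least `q^a / ((q-1)a + 1)` times (the sums lie in `[0, (q-1)a]`). [folklore] -/
theorem exists_slice (q a : ℕ) :
    ∃ (Sl : Finset (Fin a → Fin q)) (σ : ℕ), (∀ κ ∈ Sl, ∑ t, (κ t : ℕ) = σ) ∧
      q ^ a ≤ ((q - 1) * a + 1) * Sl.card := by
  classical
  -- the coordinate-sum map lands in `range ((q-1) a + 1)`
  set T : Finset ℕ := range ((q - 1) * a + 1) with hT
  set ds : (Fin a → Fin q) → ℕ := fun κ => ∑ t, (κ t : ℕ) with hds
  have hmaps : Set.MapsTo ds ↑(univ : Finset (Fin a → Fin q)) ↑T := by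
    intro κ _
    rw [mem_coe, hT, mem_range]
    have hle : ∀ t, (κ t : ℕ) ≤ q - 1 := fun t => Nat.le_sub_one_of_lt (κ t).isLt
    calc ds κ = ∑ t, (κ t : ℕ) := rfl
      _ ≤ ∑ _t : Fin a, (q - 1) := sum_le_sum fun t _ => hle t
      _ = (q - 1) * a := by rw [sum_const, card_univ, Fintype.card_fin, smul_eq_mul, mul_comm]
      _ < (q - 1) * a + 1 := Nat.lt_succ_self _
  have hTne : T.Nonempty := ⟨0, by rw [hT, mem_range]; omega⟩
  obtain ⟨σ, -, hmax⟩ :=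
    exists_max_image T (fun y => (univ.filter fun κ : Fin a → Fin q => ds κ = y).card) hTne
  refine ⟨univ.filter fun κ => ds κ = σ, σ, fun κ hκ => (mem_filter.1 hκ).2, ?_⟩
  calc q ^ a = (univ : Finset (Fin a → Fin q)).card := by
        rw [card_univ, Fintype.card_fun, Fintype.card_fin, Fintype.card_fin]
    _ = ∑ y ∈ T, (univ.filter fun κ : Fin a → Fin q => ds κ = y).card :=
        card_eq_sum_card_fiberwise hmaps
    _ ≤ ∑ _y ∈ T, (univ.filter fun κ : Fin a → Fin q => ds κ = σ).card := sum_le_sum hmax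
    _ = T.card * (univ.filter fun κ : Fin a → Fin q => ds κ = σ).card := by
        rw [sum_const, smul_eq_mul]
    _ = ((q - 1) * a + 1) * (univ.filter fun κ : Fin a → Fin q => ds κ = σ).card := by
        rw [hT, card_range]

end AutomaticDesignBelowFourFifths

/-- **The crux `AutomaticDesignBelowFourFifths` of route `AutomaticSTPPDesigns`** (item
stmt-MatrixMultiplication-7357): there exist a base `p ≥ 2` and three regular languages whose
all-scales block family is STPP in every `ℤ/(p^k)` with `p^k < ∑_w (|A_w||B_w||C_w|)^{4/5}` at
infinitely many scales.  Proof by the line `digit-sum-sliced-laser` (`q = 6`, `ℓ = 8`, `a = 18c`,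
`b = c`, `c = 10^6` kept opaque): typed free diagonal → pigeonhole slice → sliced STPP family in
`ℤ/8^{3a+3b}` (Kummer digitwise) → packing sum `> 8^{3a+3b}` → one finite cyclic design → the crux
(`crux_of_cyclicDesign`). [cite: CoppersmithWinograd1990, §7]
[cite: CohnKleinbergSzegedyUmans2005, Def. 5.1 and Lemma 5.4] -/
theorem AutomaticDesignBelowFourFifths_proof :
    Summit.MatrixMultiplication.MatrixMultiplication.Theses.AutomaticSTPPDesigns.AutomaticDesignBelowFourFifths := by
  classical
  -- parameters, opaque
  obtain ⟨c, hc⟩ : ∃ c : ℕ, 1000000 ≤ c := ⟨1000000, le_rfl⟩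
  obtain ⟨a, ha⟩ : ∃ a : ℕ, a = 18 * c := ⟨_, rfl⟩
  obtain ⟨b, hb⟩ : ∃ b : ℕ, b = c := ⟨_, rfl⟩
  -- the typed free diagonal
  obtain ⟨Δ, hwt, hpat, htyp, hfree, hsize⟩ :=
    AutomaticDesignBelowFourFifths.stub_typedFreeDiagonal a b
  -- a large slice of constant digit sum
  obtain ⟨Sl, σ, hSl, hslice⟩ := AutomaticDesignBelowFourFifths.exists_slice 6 a
  have hslice' : 6 ^ a ≤ (5 * a + 1) * Sl.card := by
    simpa only [show (6 - 1 : ℕ) = 5 by norm_num] using hslice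
  -- the sliced family is STPP in `ℤ/8^(3a+3b)` (Kummer digitwise at base 8)
  obtain ⟨A, B, C, hS, hcard⟩ :=
    AutomaticDesignBelowFourFifths.stub_slicedSTPP 6 8 (3 * a + 3 * b) a b (by norm_num) rfl
      (AutomaticDesignBelowFourFifths.stub_digitwise 8 (3 * a + 3 * b) (by norm_num)) Δ hwt hpat htyp
      hfree Sl σ hSl
  -- the packing sum beats the host
  have hlt :=
    AutomaticDesignBelowFourFifths.stub_packingCount a b c Δ.card Sl.card ha hb hc hsize hslice'
  -- C⁺, then the landed normal form
  refine AutomaticDesignBelowFourFifths.crux_of_cyclicDesign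
    ⟨8 ^ (3 * a + 3 * b), Δ.card, ?_, A, B, C, hS, ?_⟩
  · -- `2 ≤ 8 ^ (3a+3b)`
    have hN : 1 ≤ 3 * a + 3 * b := by omega
    calc (2 : ℕ) ≤ 8 ^ 1 := by norm_num
      _ ≤ 8 ^ (3 * a + 3 * b) := Nat.pow_le_pow_right (by norm_num) hN
  · -- the packing sum is `|Δ| · (|Sl|³)^{4/5}`
    have hterm : ∀ i : Fin Δ.card,
        (((A i).card * (B i).card * (C i).card : ℕ) : ℝ) ^ ((4 : ℝ) / 5) =
          (((Sl.card * Sl.card * Sl.card : ℕ) : ℝ)) ^ ((4 : ℝ) / 5) := by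
      intro i
      obtain ⟨h1, h2, h3⟩ := hcard i
      rw [h1, h2, h3]
    rw [sum_congr rfl fun i _ => hterm i, sum_const, card_univ, Fintype.card_fin, nsmul_eq_mul]
    exact hlt

end Summit.MatrixMultiplication.MatrixMultiplication.Theorems

end
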